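import Mathlib

/-!
# Solo-blind seat (MatrixMultiplication), s68 — the cyclic obstruction to the extension property
(paper/ZSF-classification.md, TRIANGLE.md (R18.15), CLAIMS c673 (ii) / c677 (c))

The extension property "every zero-sum-free sequence extends to one of the maximal length `D(G) - 1`" fails in
every finite abelian group of exponent `m ≥ 4`: in `ℤ/m` with `m = a + 2b + 1` (`a ≥ 1`, `b ≥ 1`) the sequence
`1^a 2^b` of length `a + b < m - 1 = D(ℤ/m) - 1` is zero-sum free and STUCK — every `g` is cancelled by a sub-sum,
so no term (new or repeated) can be appended (`soloBlindCyc_zsf`, `soloBlindCyc_stuck`).  With `a ∈ {1, 2}` this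
covers every `m ≥ 4`; the direct-sum lemma `soloBlind_join_stuck` (file `SoloBlindMaximalProduct`) then transports
the obstruction to `ℤ/m × H`.  Together with the kernel-certified rank-6 example (`SoloBlindMaximalZSF`) these are
the negative halves of the classification: the extension property holds exactly for elementary 2-groups and `C₃^r`,
`r ≤ 5` (the positive half for `C₃^r`, `r ≤ 5`, is an exhaustive computation).  Pure finite combinatorics.
-/

set_option linter.dupNamespace false
set_option autoImplicit false

namespace Summit.MatrixMultiplication.MatrixMultiplication.Theorems

open Finset BigOperators

/-- The sequence `1^a 2^b` in `ℤ/(a+2b+1)`, indexed by `Fin a ⊕ Fin b`. -/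
def soloBlindCyc (a b : ℕ) : Fin a ⊕ Fin b → ZMod (a + 2 * b + 1) :=
  Sum.elim (fun _ => 1) (fun _ => 2)

/-- Sub-sums of `1^a 2^b`: `#ones + 2·#twos`. -/
theorem soloBlindCyc_sum (a b : ℕ) (T : Finset (Fin a ⊕ Fin b)) :
    ∑ x ∈ T, soloBlindCyc a b x = ((T.toLeft.card + 2 * T.toRight.card : ℕ) : ZMod (a + 2 * b + 1)) := by
  rw [Finset.sum_sum_eq_sum_toLeft_add_sum_toRight]
  simp only [soloBlindCyc, Sum.elim_inl, Sum.elim_inr, Finset.sum_const, nsmul_eq_mul, mul_one]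
  push_cast
  ring

/-- `1^a 2^b` is zero-sum free in `ℤ/(a+2b+1)` (all sub-sums are naturals `≤ a + 2b < m`). -/
theorem soloBlindCyc_zsf (a b : ℕ) (T : Finset (Fin a ⊕ Fin b))
    (hT : ∑ x ∈ T, soloBlindCyc a b x = 0) : T = ∅ := by
  rw [soloBlindCyc_sum, ZMod.natCast_eq_zero_iff] at hT
  have h1 : T.toLeft.card ≤ a := by simpa using Finset.card_le_univ T.toLeft
  have h2 : T.toRight.card ≤ b := by simpa using Finset.card_le_univ T.toRight
  have h0 := Nat.eq_zero_of_dvd_of_lt hT (by omega)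
  have hl : T.toLeft = ∅ := Finset.card_eq_zero.mp (by omega)
  have hr : T.toRight = ∅ := Finset.card_eq_zero.mp (by omega)
  rw [← Finset.toLeft_disjSum_toRight (u := T), hl, hr]
  exact Finset.disjSum_eq_empty.mpr ⟨rfl, rfl⟩

/-- `1^a 2^b` (`a ≥ 1`) is STUCK in `ℤ/(a+2b+1)`: every `g` satisfies `g + (sub-sum) = 0`, so nothing can be appended. -/
theorem soloBlindCyc_stuck (a b : ℕ) (ha : 1 ≤ a) (g : ZMod (a + 2 * b + 1)) :
    ∃ T : Finset (Fin a ⊕ Fin b), g + ∑ x ∈ T, soloBlindCyc a b x = 0 := by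
  set t := (-g).val with ht_def
  have ht : t < a + 2 * b + 1 := ZMod.val_lt _
  obtain ⟨c₂, hc₂b, hc₂t, hc₂⟩ : ∃ c₂ : ℕ, c₂ ≤ b ∧ 2 * c₂ ≤ t ∧ t - 2 * c₂ ≤ a := by
    rcases le_total b (t / 2) with h | h
    · exact ⟨b, le_rfl, by omega, by omega⟩
    · exact ⟨t / 2, h, by omega, by omega⟩
  obtain ⟨L, -, hL⟩ := Finset.exists_subset_card_eq (s := (Finset.univ : Finset (Fin a)))
    (n := t - 2 * c₂) (by simpa using hc₂)
  obtain ⟨Rr, -, hR⟩ := Finset.exists_subset_card_eq (s := (Finset.univ : Finset (Fin b)))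
    (n := c₂) (by simpa using hc₂b)
  refine ⟨L.disjSum Rr, ?_⟩
  rw [soloBlindCyc_sum, Finset.toLeft_disjSum, Finset.toRight_disjSum, hL, hR,
    show t - 2 * c₂ + 2 * c₂ = t by omega, ht_def, ZMod.natCast_zmod_val, add_neg_cancel]

/-- THE CYCLIC OBSTRUCTION (CLAIMS c673 (ii)): for all `a ≥ 1`, `b ≥ 1`, the group `ℤ/(a+2b+1)` carries a zero-sum-free
stuck sequence of length `a + b`, one that is strictly shorter than the maximal length `a + 2b = D - 1`.  (`a = 1`:
even moduli `≥ 4`; `a = 2`: odd moduli `≥ 5`.) -/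
theorem soloBlind_cyclic_extension_fails (a b : ℕ) (ha : 1 ≤ a) :
    ∃ f : Fin a ⊕ Fin b → ZMod (a + 2 * b + 1),
      (∀ T : Finset (Fin a ⊕ Fin b), ∑ x ∈ T, f x = 0 → T = ∅) ∧
      (∀ g : ZMod (a + 2 * b + 1), ∃ T : Finset (Fin a ⊕ Fin b), g + ∑ x ∈ T, f x = 0) ∧
      Fintype.card (Fin a ⊕ Fin b) = a + b :=
  ⟨soloBlindCyc a b, soloBlindCyc_zsf a b, soloBlindCyc_stuck a b ha, by simp⟩

end Summit.MatrixMultiplication.MatrixMultiplication.Theorems
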